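import Summits.Ventures.HodgeRepro2.DefiniteAnisotropic
import Summits.Ventures.HodgeRepro2.BallStabilizerBounded

/-!
# AnisotropicBoundary — anisotropy of the hermitian space means: NO `K`-rational point on the boundary of the
ball (the «no cusps» face of Godement's criterion, at the level of the form) (p2 annex row 160)

Cell pub-hodge-repro2, Tier 5 kernel annex (seat p2, Shimura-data side). Proof lane (no new definition).
§8(d): uses an L-value-free non-vanishing device: NO.

In the frame `Q` (`Q* J₂₁ Q = τ₁(H)`, `det Q ≠ 0`) the `K`-rational vectors of the hermitian space are the
`w = Q τ₁(v)`, `v ∈ K³`, and the indefinite form `J₂₁` pulls back to `H`: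
`hermPair_mulVec_frame` / `hermPair_frame_map` (`⟨Q τ₁(x), Q τ₁(y)⟩_{J₂₁} = τ₁(x* H y)`). Hence
(`hermPair_frame_self_ne_zero_of_isAnisotropic`, `hermJ21_frame_ne_zero_of_isAnisotropic`) the form `H` is
ANISOTROPIC iff no non-zero `K`-rational vector is `J₂₁`-isotropic (`isAnisotropic_iff_hermJ21_frame_ne_zero`);
in particular no `K`-rational line meets the boundary sphere `‖z‖ = 1` of the ball: for `v ≠ 0` with
`(Q τ₁ v)₂ ≠ 0` the point `z = ((Qτ₁v)₀/(Qτ₁v)₂, (Qτ₁v)₁/(Qτ₁v)₂)` has `‖z₀‖² + ‖z₁‖² ≠ 1`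
(`normSq_frame_point_ne_one_of_isAnisotropic`). With row 152's `isAnisotropic_of_two_lt_finrank` this holds
for the record's Picard datum whenever `[K : ℚ] > 2`: the arithmetic quotient `Γ₁\𝔹²` has no rational boundary
points (no cusps) — the hypothesis side of Godement's compactness criterion; the criterion itself stays prose.

No `sorry`; `#print axioms` ⊆ {propext, Classical.choice, Quot.sound}.
-/

namespace Summit.Ventures.HodgeRepro2.ShimuraData

open Matrix

variable {K : Type*} [Field K] [NumberField K] [NumberField.IsCMField K]
  {τ₁ : K →+* ℂ} {H : Matrix (Fin 3) (Fin 3) K} {Q : Matrix (Fin 3) (Fin 3) ℂ}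

omit [NumberField K] [NumberField.IsCMField K] in
/-- In a frame `Q` the indefinite form `J₂₁` pulls back to `τ₁(H)`:
`⟨Q x, Q y⟩_{J₂₁} = star x ⬝ᵥ τ₁(H) y`. -/
theorem hermPair_mulVec_frame (hQ : IsFrame K τ₁ H Q) (x y : Fin 3 → ℂ) :
    hermPair (Q.mulVec x) (Q.mulVec y) = star x ⬝ᵥ (H.map τ₁).mulVec y := by
  unfold hermPair
  rw [Matrix.star_mulVec, Matrix.mulVec_mulVec, ← Matrix.dotProduct_mulVec, Matrix.mulVec_mulVec,
    ← mul_assoc, hQ.1]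

/-- `⟨Q τ₁(x), Q τ₁(y)⟩_{J₂₁} = τ₁(x* H y)` for `x, y ∈ K³`. -/
theorem hermPair_frame_map (hQ : IsFrame K τ₁ H Q) (x y : Fin 3 → K) :
    hermPair (Q.mulVec (τ₁ ∘ x)) (Q.mulVec (τ₁ ∘ y)) = τ₁ (hermDot H x y) := by
  rw [hermPair_mulVec_frame hQ, map_hermDot]

omit [NumberField K] [NumberField.IsCMField K] in
/-- `⟨w, w⟩_{J₂₁}` is the real number `‖w₀‖² + ‖w₁‖² − ‖w₂‖²`. -/
theorem hermPair_self_eq_hermJ21 (w : Fin 3 → ℂ) : hermPair w w = (hermJ21 w : ℂ) := by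
  have h : ∀ z : ℂ, (starRingEnd ℂ) z * z = (‖z‖ : ℂ) ^ 2 := fun z => Complex.conj_mul' z
  simp only [hermPair, hermJ21, J21, Matrix.mulVec_diagonal, dotProduct, Fin.sum_univ_three,
    Pi.star_apply, Complex.star_def]
  simp only [Matrix.cons_val_zero, Matrix.cons_val_one, Matrix.cons_val_two, Matrix.head_cons,
    Matrix.tail_cons, Complex.ofReal_sub, Complex.ofReal_add, Complex.ofReal_pow]
  rw [← h, ← h, ← h]
  ring

/-- For anisotropic `H` and `v ≠ 0` in `K³`, the rational vector `Q τ₁(v)` is not `J₂₁`-isotropic. -/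
theorem hermPair_frame_self_ne_zero_of_isAnisotropic (hQ : IsFrame K τ₁ H Q) (ha : IsAnisotropic H)
    {v : Fin 3 → K} (hv : v ≠ 0) : hermPair (Q.mulVec (τ₁ ∘ v)) (Q.mulVec (τ₁ ∘ v)) ≠ 0 := by
  rw [hermPair_frame_map hQ]
  intro h
  have h0 : hermDot H v v = 0 := by
    have := (map_eq_zero_iff τ₁ τ₁.injective).mp h
    exact this
  exact hv (ha v h0)

/-- For anisotropic `H` and `v ≠ 0` in `K³`: `‖(Qτ₁v)₀‖² + ‖(Qτ₁v)₁‖² − ‖(Qτ₁v)₂‖² ≠ 0`. -/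
theorem hermJ21_frame_ne_zero_of_isAnisotropic (hQ : IsFrame K τ₁ H Q) (ha : IsAnisotropic H)
    {v : Fin 3 → K} (hv : v ≠ 0) : hermJ21 (Q.mulVec (τ₁ ∘ v)) ≠ 0 := by
  intro h
  apply hermPair_frame_self_ne_zero_of_isAnisotropic hQ ha hv
  rw [hermPair_self_eq_hermJ21, h, Complex.ofReal_zero]

/-- `H` is anisotropic iff no non-zero `K`-rational vector `Q τ₁(v)` is `J₂₁`-isotropic. -/
theorem isAnisotropic_iff_hermJ21_frame_ne_zero (hQ : IsFrame K τ₁ H Q) :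
    IsAnisotropic H ↔ ∀ v : Fin 3 → K, v ≠ 0 → hermJ21 (Q.mulVec (τ₁ ∘ v)) ≠ 0 := by
  refine ⟨fun ha v hv => hermJ21_frame_ne_zero_of_isAnisotropic hQ ha hv, fun h v hv => ?_⟩
  by_contra hv0
  apply h v hv0
  have : hermPair (Q.mulVec (τ₁ ∘ v)) (Q.mulVec (τ₁ ∘ v)) = 0 := by
    rw [hermPair_frame_map hQ, hv, map_zero]
  rw [hermPair_self_eq_hermJ21] at this
  exact_mod_cast this

omit [NumberField K] [NumberField.IsCMField K] in
/-- For `w₂ ≠ 0`, `hermJ21 w = ‖w₂‖² · (‖w₀/w₂‖² + ‖w₁/w₂‖² − 1)`. -/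
theorem hermJ21_eq_mul_normSq_sub_one (w : Fin 3 → ℂ) (hw : w 2 ≠ 0) :
    hermJ21 w = ‖w 2‖ ^ 2 * ((‖w 0 / w 2‖ ^ 2 + ‖w 1 / w 2‖ ^ 2) - 1) := by
  have h2 : ‖w 2‖ ≠ 0 := norm_ne_zero_iff.mpr hw
  simp only [hermJ21, norm_div, div_pow]
  field_simp

/-- NO `K`-RATIONAL POINT ON THE BOUNDARY OF THE BALL: for anisotropic `H`, `v ≠ 0` in `K³` and
`w = Q τ₁(v)` with `w₂ ≠ 0`, the point `z = (w₀/w₂, w₁/w₂)` of the affine chart satisfies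
`‖z₀‖² + ‖z₁‖² ≠ 1` — it is either inside the ball or outside its closure, never on the sphere. -/
theorem normSq_frame_point_ne_one_of_isAnisotropic (hQ : IsFrame K τ₁ H Q) (ha : IsAnisotropic H)
    {v : Fin 3 → K} (hv : v ≠ 0) (hw : Q.mulVec (τ₁ ∘ v) 2 ≠ 0) :
    ‖Q.mulVec (τ₁ ∘ v) 0 / Q.mulVec (τ₁ ∘ v) 2‖ ^ 2 + ‖Q.mulVec (τ₁ ∘ v) 1 / Q.mulVec (τ₁ ∘ v) 2‖ ^ 2 ≠ 1 := by
  intro h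
  apply hermJ21_frame_ne_zero_of_isAnisotropic hQ ha hv
  rw [hermJ21_eq_mul_normSq_sub_one _ hw, h, sub_self, mul_zero]

/-- The record's Picard datum (`IsPicardSignature`'s definiteness clause, `[K : ℚ] > 2`) has no `K`-rational
boundary point (rows 152 + this file). -/
theorem normSq_frame_point_ne_one_of_two_lt_finrank (hH : IsHermitianForm K H)
    (hdef : ∀ τ : K →+* ℂ, NumberField.InfinitePlace.mk τ ≠ NumberField.InfinitePlace.mk τ₁ →
      IsDefiniteAt K τ H)
    (hK : 2 < Module.finrank ℚ K) (hQ : IsFrame K τ₁ H Q) {v : Fin 3 → K} (hv : v ≠ 0)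
    (hw : Q.mulVec (τ₁ ∘ v) 2 ≠ 0) :
    ‖Q.mulVec (τ₁ ∘ v) 0 / Q.mulVec (τ₁ ∘ v) 2‖ ^ 2 + ‖Q.mulVec (τ₁ ∘ v) 1 / Q.mulVec (τ₁ ∘ v) 2‖ ^ 2 ≠ 1 :=
  normSq_frame_point_ne_one_of_isAnisotropic hQ (isAnisotropic_of_two_lt_finrank hH hdef hK) hv hw

end Summit.Ventures.HodgeRepro2.ShimuraData
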